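import Literature.Computability.Cryptography.HallgrenClassGroupIdealCountLower
import Literature.GroupTheory.FiniteAbelian.TorsionWitnessStatistic
import HarnessLib

/-!
# Hallgren 2005 / class groups — torsion witnesses are numerous: ideals of bounded norm whose class
# has order divisible by `3`

Topic `Literature/Computability/Cryptography`; proof companion of `HallgrenClassGroupIdealCountLower.lean`
(per-class lower bound) and `Literature/GroupTheory/FiniteAbelian/TorsionWitnessStatistic.lean`
(`≥ 2/3` of the classes have order divisible by `3` when `3 ∣ h_K`). Theorems only.

The completeness of the unconditional torsion-witness test for `3 ∣ h(−d)` (draw a near-uniform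
ideal `𝔞` of norm `≤ N` of `K = ℚ(√−d)`, compute the order of `[𝔞]` by phase estimation, accept iff
`3` divides it) rests on ONE count, proved here:

* `le_card_ideals_of_classes` — for a set `S` of ideal classes,
  `#S · (2N/√|d_K| − 2√N − 1) ≤ #{𝔞 ≠ 0 : N𝔞 ≤ N, [𝔞] ∈ S}` (disjoint union of the per-class bounds);
* `le_card_ideals_three_dvd_orderOf` — if `3 ∣ h_K` then
  `(2/3) h_K (2N/√|d_K| − 2√N − 1) ≤ #{𝔞 ≠ 0 : N𝔞 ≤ N, 3 ∣ ord [𝔞]}`.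

With `h_K ≥ c√|d_K|/(π log |d_K|)` (`Quadratic.le_classNumber_of_dedekindZeta_residue_ge`) the right
side is `≫_c N / log |d_K|` for `N ≥ |d_K| (log |d_K|)²`, a `1/poly(log d)` fraction of all ideals of norm `≤ N`.

## References

* K. K. H. Cheung, M. Mosca, *Decomposing finite abelian groups*, QIC 1 (2001), §3 [CheungMosca2001].
* H. Davenport, *Multiplicative Number Theory*, 2nd ed., GTM 74 (1980), Ch. 6 [DavenportMNT1980].
* A. M. Childs, W. van Dam, Rev. Mod. Phys. 82 (2010), §5.7 [ChildsVandam2010].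
-/

noncomputable section

open scoped nonZeroDivisors
open Module NumberField Finset
open Literature.NumberTheory.EllipticCurves

namespace Literature.Computability.Cryptography.Hallgren2005

variable {K : Type*} [Field K] [NumberField K]

/-- **Ideals of bounded norm in a set of classes.** For an imaginary quadratic field `K` with
`d_K < −4`, a finite set `S` of ideal classes and `N`:
`#S · (2N/√|d_K| − 2√N − 1) ≤ #{𝔞 ≠ 0 : N𝔞 ≤ N, [𝔞] ∈ S}` (the per-class bound
`le_card_ideals_of_class`, summed over the disjoint classes). [cite: DavenportMNT1980, Ch. 6] -/
theorem le_card_ideals_of_classes (hK : IsImaginaryQuadratic K) (hd4 : NumberField.discr K < -4)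
    (S : Finset (ClassGroup (𝓞 K))) (N : ℕ) :
    (S.card : ℝ) * (2 * N / Real.sqrt (-(NumberField.discr K) : ℝ) - 2 * Real.sqrt N - 1) ≤
      Set.ncard {I : Ideal (𝓞 K) | I ≠ ⊥ ∧ Ideal.absNorm I ≤ N ∧
        ∃ hI : I ∈ (Ideal (𝓞 K))⁰, ClassGroup.mk0 ⟨I, hI⟩ ∈ S} := by
  classical
  set B : ℝ := 2 * N / Real.sqrt (-(NumberField.discr K) : ℝ) - 2 * Real.sqrt N - 1 with hB
  -- the finite set of non-zero ideals of norm `≤ N` and the class map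
  set 𝓘 : Finset (Ideal (𝓞 K)) :=
    (Ideal.finite_setOf_absNorm_le (S := 𝓞 K) N).toFinset.filter (fun I => I ≠ ⊥) with h𝓘
  have hmem𝓘 : ∀ {I : Ideal (𝓞 K)}, I ∈ 𝓘 ↔ I ≠ ⊥ ∧ Ideal.absNorm I ≤ N := by
    intro I
    rw [h𝓘, mem_filter, Set.Finite.mem_toFinset, Set.mem_setOf_eq, and_comm]
  let cls : Ideal (𝓞 K) → ClassGroup (𝓞 K) := fun I =>
    if h : I = ⊥ then 1 else ClassGroup.mk0 ⟨I, mem_nonZeroDivisors_of_ne_zero (by simpa using h)⟩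
  have hcls : ∀ {I : Ideal (𝓞 K)} (hI : I ∈ (Ideal (𝓞 K))⁰), cls I = ClassGroup.mk0 ⟨I, hI⟩ := by
    intro I hI
    have hI0 : I ≠ ⊥ := by simpa using nonZeroDivisors.ne_zero hI
    simp only [cls, dif_neg hI0]
  -- per class: the class set is the fibre of `cls`
  have hfibre : ∀ c : ClassGroup (𝓞 K),
      {I : Ideal (𝓞 K) | I ≠ ⊥ ∧ Ideal.absNorm I ≤ N ∧
        ∃ hI : I ∈ (Ideal (𝓞 K))⁰, ClassGroup.mk0 ⟨I, hI⟩ = c} = ↑(𝓘.filter fun I => cls I = c) := by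
    intro c
    ext I
    simp only [Set.mem_setOf_eq, coe_filter, hmem𝓘]
    constructor
    · rintro ⟨hI0, hIN, hI, hc⟩
      exact ⟨⟨hI0, hIN⟩, by rw [hcls hI, hc]⟩
    · rintro ⟨⟨hI0, hIN⟩, hc⟩
      have hI : I ∈ (Ideal (𝓞 K))⁰ := mem_nonZeroDivisors_of_ne_zero (by simpa using hI0)
      exact ⟨hI0, hIN, hI, by rw [← hcls hI, hc]⟩
  have htarget : {I : Ideal (𝓞 K) | I ≠ ⊥ ∧ Ideal.absNorm I ≤ N ∧
      ∃ hI : I ∈ (Ideal (𝓞 K))⁰, ClassGroup.mk0 ⟨I, hI⟩ ∈ S} = ↑(𝓘.filter fun I => cls I ∈ S) := by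
    ext I
    simp only [Set.mem_setOf_eq, coe_filter, hmem𝓘]
    constructor
    · rintro ⟨hI0, hIN, hI, hc⟩
      exact ⟨⟨hI0, hIN⟩, by rw [hcls hI]; exact hc⟩
    · rintro ⟨⟨hI0, hIN⟩, hc⟩
      have hI : I ∈ (Ideal (𝓞 K))⁰ := mem_nonZeroDivisors_of_ne_zero (by simpa using hI0)
      exact ⟨hI0, hIN, hI, by rw [← hcls hI]; exact hc⟩
  have hper : ∀ c ∈ S, B ≤ ((𝓘.filter fun I => cls I = c).card : ℝ) := by
    intro c _
    have h := le_card_ideals_of_class hK hd4 c N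
    rw [hfibre c, Set.ncard_coe_finset] at h
    exact h
  rw [htarget, Set.ncard_coe_finset, ← sum_card_fiberwise_eq_card_filter 𝓘 S cls]
  push_cast
  have h := Finset.card_nsmul_le_sum S (fun c => ((𝓘.filter fun I => cls I = c).card : ℝ)) B hper
  rw [nsmul_eq_mul] at h
  exact h

/-- **Torsion witnesses are numerous.** For an imaginary quadratic field `K` with `d_K < −4` and
`3 ∣ h_K`: `(2/3) h_K (2N/√|d_K| − 2√N − 1) ≤ #{𝔞 ≠ 0 : N𝔞 ≤ N, 3 ∣ ord [𝔞]}` — at least two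
thirds of the classes have order divisible by `3`
(`two_mul_card_le_three_mul_card_filter_three_dvd_orderOf`) and each contains
`≥ 2N/√|d_K| − 2√N − 1` ideals of norm `≤ N` (`le_card_ideals_of_class`). [cite: CheungMosca2001, §3] -/
theorem le_card_ideals_three_dvd_orderOf (hK : IsImaginaryQuadratic K)
    (hd4 : NumberField.discr K < -4) (h3 : 3 ∣ Fintype.card (ClassGroup (𝓞 K))) (N : ℕ) :
    (2 / 3 : ℝ) * Fintype.card (ClassGroup (𝓞 K)) *
        (2 * N / Real.sqrt (-(NumberField.discr K) : ℝ) - 2 * Real.sqrt N - 1) ≤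
      Set.ncard {I : Ideal (𝓞 K) | I ≠ ⊥ ∧ Ideal.absNorm I ≤ N ∧
        ∃ hI : I ∈ (Ideal (𝓞 K))⁰, 3 ∣ orderOf (ClassGroup.mk0 ⟨I, hI⟩)} := by
  classical
  set B : ℝ := 2 * N / Real.sqrt (-(NumberField.discr K) : ℝ) - 2 * Real.sqrt N - 1 with hB
  set S : Finset (ClassGroup (𝓞 K)) := univ.filter fun c => 3 ∣ orderOf c with hS
  have hgood : (2 : ℝ) * Fintype.card (ClassGroup (𝓞 K)) ≤ 3 * S.card := by
    exact_mod_cast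
      Literature.GroupTheory.FiniteAbelian.two_mul_card_le_three_mul_card_filter_three_dvd_orderOf _ h3
  have hset : {I : Ideal (𝓞 K) | I ≠ ⊥ ∧ Ideal.absNorm I ≤ N ∧
      ∃ hI : I ∈ (Ideal (𝓞 K))⁰, 3 ∣ orderOf (ClassGroup.mk0 ⟨I, hI⟩)} =
      {I : Ideal (𝓞 K) | I ≠ ⊥ ∧ Ideal.absNorm I ≤ N ∧
        ∃ hI : I ∈ (Ideal (𝓞 K))⁰, ClassGroup.mk0 ⟨I, hI⟩ ∈ S} := by
    ext I
    simp only [Set.mem_setOf_eq, hS, mem_filter, mem_univ, true_and]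
  rw [hset]
  have h := le_card_ideals_of_classes hK hd4 S N
  rcases le_or_gt 0 B with hB0 | hB0
  · calc (2 / 3 : ℝ) * Fintype.card (ClassGroup (𝓞 K)) * B ≤ S.card * B := by
          apply mul_le_mul_of_nonneg_right _ hB0
          linarith
      _ ≤ _ := h
  · have h0 : (0 : ℝ) ≤ Set.ncard {I : Ideal (𝓞 K) | I ≠ ⊥ ∧ Ideal.absNorm I ≤ N ∧
        ∃ hI : I ∈ (Ideal (𝓞 K))⁰, ClassGroup.mk0 ⟨I, hI⟩ ∈ S} := Nat.cast_nonneg _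
    have hneg : (2 / 3 : ℝ) * Fintype.card (ClassGroup (𝓞 K)) * B ≤ 0 :=
      mul_nonpos_of_nonneg_of_nonpos (by positivity) hB0.le
    linarith

end Literature.Computability.Cryptography.Hallgren2005

end
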